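import Summits.Ventures.PercRepro2.CaseOneStarCertT1
import Summits.Ventures.PercRepro2.CaseOneGadgetUWA1BBlockI0
import Summits.Ventures.PercRepro2.CaseOneGadgetUWA1BBlockI1
import Summits.Ventures.PercRepro2.CaseOneGadgetUWA1BBlockI2
import Summits.Ventures.PercRepro2.CaseOneGadgetUWA1BBlockI3
import Summits.Ventures.PercRepro2.CaseOneGadgetUWA1BBlockI4
import Summits.Ventures.PercRepro2.CaseOneGadgetUWA1BBlockI5
import Summits.Ventures.PercRepro2.CaseOneGadgetUWA1BBlockI6
import Summits.Ventures.PercRepro2.CaseOneGadgetUWA1BBlockI7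
import Summits.Ventures.PercRepro2.CaseOneGadgetUWA1BBlockI8
import Summits.Ventures.PercRepro2.CaseOneGadgetUWA1BBlockI9
import Summits.Ventures.PercRepro2.CaseOneGadgetUWA1BBlockI10
import Summits.Ventures.PercRepro2.CaseOneGadgetUWA1BBlockI11
import Summits.Ventures.PercRepro2.CaseOneGadgetUWA1BBlockI12
import Summits.Ventures.PercRepro2.CaseOneGadgetUWA1BBlockI13
import Summits.Ventures.PercRepro2.CaseOneGadgetUWA1BBlockI14
import Summits.Ventures.PercRepro2.CaseOneStarFactsB

/-!
# The gadget `u ~ {w, a₁, b}`, `w ~ {u, a₂, o}` (uwa1b): the cell certificates of `iAB5` (part 38a)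
(blind cell PercRepro2, p1 g34; the fourth gadget anchor of the six-form calculus — all six forms of the uwa1b gadget
as plain SFacts-cone certificate chains, generated by mining/p1/g34/uwa1b/genu.py = p1 g33's gent_uwa1.py / g25's
geno.py re-targeted; P1-G33 §6–§6″, P1-G34)

Each `eBABI ijk kl` is a nonnegative combination of `(pairwise atom) × (cell)` and cubic cell monomials — or, for the degree-4 ones, `M × eBABI ijk kl` (`M = Σ cᵢ` the total cell mass) is a nonnegative combination of `(atom) × (cell) × (cell)` and quartic cell monomials, then `SFacts.nonneg_of_sum_mul` (`CaseOneStarCertT1`) — exact LP certificates (kit j319447, every certificate re-verified exactly; data/p1/g33/gcerts_i_uwa1b.json, form `i`), here as exact `linear_combination`s over `SFacts` (the rational coefficients cleared by their common denominator). -/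

namespace Summit.Ventures.PercRepro2

namespace CaseOne

section CertABI38a
variable {R : Type*} [Field R] [LinearOrder R] [IsStrictOrderedRing R]

set_option maxHeartbeats 0 in
/-- `eBABI31321 ≥ 0`: the combination is identically zero (`ring`). -/
lemma eBABI31321_nonneg (m : SCells R) (_hf : SFactsB m) : 0 ≤ eBABI31321 m := by
  have h : eBABI31321 m = 0 := by
    unfold eBABI31321 cBABI00121 cBABI00221 cBABI01021 cBABI01121 cBABI01221 cBABI01321 cBABI10021 cBABI10121 cBABI10221 cBABI10321 cBABI11021 cBABI11121 cBABI11221 cBABI11321 cBABI20021 cBABI20121 cBABI20221 cBABI20321 cBABI21021 cBABI21121 cBABI21221 cBABI21321 cBABI30121 cBABI30221 cBABI30321 cBABI31021 cBABI31121 cBABI31221 cBABI31321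
    ring
  linarith [h]

set_option maxHeartbeats 0 in
/-- `eBABI31322 ≥ 0`: the combination is identically zero (`ring`). -/
lemma eBABI31322_nonneg (m : SCells R) (_hf : SFactsB m) : 0 ≤ eBABI31322 m := by
  have h : eBABI31322 m = 0 := by
    unfold eBABI31322 cBABI00122 cBABI00222 cBABI01022 cBABI01122 cBABI01222 cBABI01322 cBABI10022 cBABI10122 cBABI10222 cBABI10322 cBABI11022 cBABI11122 cBABI11222 cBABI11322 cBABI20022 cBABI20122 cBABI20222 cBABI20322 cBABI21022 cBABI21122 cBABI21222 cBABI21322 cBABI30122 cBABI30222 cBABI30322 cBABI31022 cBABI31122 cBABI31222 cBABI31322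
    ring
  linarith [h]

end CertABI38a

end CaseOne

end Summit.Ventures.PercRepro2
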